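import Summits.AnomalousDissipation.AnomalousDissipation.Theorems.SolenoidalFractalHomogenisationLagrangianStepSidebandXDefectLinks
import Summits.AnomalousDissipation.AnomalousDissipation.Theorems.SolenoidalFractalHomogenisationLagrangianStepSidebandXDefectSum
import HarnessLib

/-!
# K1L_D `LagrangianRenormalisationStepDesign` (stmt-AnomalousDissipation-27980), `stub_D1_V0` (V0 = clause (ii) of
# `WCrossing.D1ExactFamily`), brick T4c-3d (D1 assembled): THE COMMUTATOR DEFECT PAIRED WITH THE RESIDUAL —
# `2⟪r, genX(projX y) − projX(gen y)⟫_ℝ ≤ ¼𝒟(r) + C_v·ξ²·‖y‖² + C_l·ξ·‖r‖·‖y‖` (helper; `--kind proof --supports stmt-AnomalousDissipation-27980 --as helper`)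

Summits-side helper file of route `SolenoidalFractalHomogenisation` (prover seat `ad-k1l-cellLawV-w1` g6).  Everything proved; no definitions, no named
facts, no sorry.  The first defect group of `…SidebandXResidual.hasDerivWithinAt_residual`, summed over the box against a class-transversal residual `r`
and a `z`-transversal reference state `y` (`projX 1 0 R y = y`, `…SidebandResponseTransversal`), with `𝔹 = (1/n²)•𝔸`, `2|ℓ| ≤ n`, window data
`NearIso 𝔸 lo hi` (`lo > 0`, `hi ≥ 0`), `OddSmall 𝔸 β` (`β ≥ 0`), `ξ := √|ℓ|²/n`, `K₀ := hi + β/2`, dissipation form `𝒟(r) := 8π²(lo/n²)·Σ_z |k_z|²‖r_z‖²`: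
* `norm_projX_le` — `‖projX v‖ ≤ ‖v‖`;
* `sqrt_freqNormSq_classFreq_ge_half` — `√|k_z|² ≥ n√|z|²/2` on the box (`2|ℓ| ≤ n`);
* **`two_abs_re_inner_visc_le`** — per class point: `2|Re⟪r_z, visc_z⟫| ≤ ¼·8π²(lo/n²)|k_z|²‖r_z‖² + (32π²·534²·K₀²/lo)·ξ²·‖y_z‖²`;
* **`two_real_inner_D1_le`** — `2⟪r, genX t (projX y) − projX (gen t y)⟫_ℝ ≤ ¼𝒟(r) + (32π²534²K₀²/lo)·ξ²‖y‖² + 4·(Σⱼ 2π‖αⱼ‖(5 + 3|mⱼ|))·ξ·‖r‖‖y‖`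
  (memo `Cruxes/LagrangianRenormalisationStepDesign/Lines/onelevel-V0-residual.md` §3, D1; skeleton `Lines/onelevel_V0_energy.lean`).
NOT a proof of any registered stub, of K1L_D, or of anomalous dissipation; rung F-D1.A0 infrastructure.
-/

set_option linter.dupNamespace false

noncomputable section

namespace Summit.AnomalousDissipation.AnomalousDissipation.Theorems.SolenoidalFractalHomogenisation.LagrangianStep.Sideband

open Set MeasureTheory Complex UnitAddTorus
open scoped InnerProductSpace
open Literature.Analysis Literature.Analysis.FunctionSpaces Literature.Analysis.FunctionSpaces.Torus
open Literature.Analysis.FluidPDE Literature.Analysis.FluidPDE.Torus Literature.Analysis.FluidPDE.LatticeShear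
open Summit.AnomalousDissipation.AnomalousDissipation.Theorems.SolenoidalFractalHomogenisation.LagrangianStep.CellChain (linkCoeff norm_transversalProj_le)

variable {k₀ : ℕ}

/-! ## §1 Two small facts -/

/-- `‖projX v‖ ≤ ‖v‖`. [cite: Temam1984, Ch. III §1.1] -/
theorem norm_projX_le {R : ℕ} (n : ℕ) (ℓ : Fin 3 → ℤ) (v : Space R) : ‖projX n ℓ R v‖ ≤ ‖v‖ := by
  have h : ‖projX n ℓ R v‖ ^ 2 ≤ ‖v‖ ^ 2 := by
    rw [PiLp.norm_sq_eq_of_L2, PiLp.norm_sq_eq_of_L2]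
    refine Finset.sum_le_sum fun z _ => ?_
    rw [projX_apply]
    exact pow_le_pow_left₀ (norm_nonneg _) (norm_transversalProj_le _ _) 2
  exact (pow_le_pow_iff_left₀ (norm_nonneg _) (norm_nonneg _) two_ne_zero).1 h

/-- `√|k_z|² ≥ n√|z|²/2` for `z ∈ box R` when `2√|ℓ|² ≤ n`. [folklore] -/
theorem sqrt_freqNormSq_classFreq_ge_half {n : ℕ} {ℓ : Fin 3 → ℤ} (hℓ : 2 * Real.sqrt (freqNormSq ℓ) ≤ n) {R : ℕ} (z : box R) :
    (n : ℝ) * Real.sqrt (freqNormSq z.1) / 2 ≤ Real.sqrt (freqNormSq (classFreq n ℓ z.1)) := by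
  have h1 := sqrt_freqNormSq_classFreq_ge n ℓ z.1
  have hZ : 1 ≤ Real.sqrt (freqNormSq z.1) := by
    rw [← Real.sqrt_one]; exact Real.sqrt_le_sqrt (Torus.one_le_freqNormSq_of_ne_zero (ne_zero_of_mem_box z.2))
  have hn : (0 : ℝ) ≤ n := Nat.cast_nonneg n
  nlinarith [mul_le_mul_of_nonneg_left hZ hn]

/-! ## §2 The viscous group, per class point -/

/-- **Viscous group, Young against the dissipation weight**: for `z ∈ box R`, class-transversal `r_z`, any `y_z`,
`2|Re⟪r_z, 4π²•(P_kT_{𝔹ᵀ}(k)P_k y_z − P_kP_zT_{𝔸ᵀ}(z)P_z y_z)⟫| ≤ ¼·(8π²(lo/n²)|k_z|²)‖r_z‖² + (32π²·534²·K₀²/lo)·ξ²·‖y_z‖²`.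
[cite: Frisch1995Turbulence, §9.6.3 eq. (9.57) p. 233] -/
theorem two_abs_re_inner_visc_le {𝔸 : Torus.Visc4 (Fin 3)} {lo hi β : ℝ} (h𝔸 : Torus.NearIso 𝔸 lo hi) (hlo : 0 < lo) (hhi : 0 ≤ hi)
    (hodd : Torus.OddSmall 𝔸 β) (hβ : 0 ≤ β) {n : ℕ} (hn : n ≠ 0) {ℓ : Fin 3 → ℤ} (hℓ : 2 * Real.sqrt (freqNormSq ℓ) ≤ n)
    {R : ℕ} (z : box R) {r : EuclideanSpace ℂ (Fin 3)} (hr : transversalProj (classFreq n ℓ z.1) r = r) (y : EuclideanSpace ℂ (Fin 3)) :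
    2 * |(⟪r, (((4 * Real.pi ^ 2 : ℝ) : ℂ)) • (transversalProj (classFreq n ℓ z.1)
          (Torus.symbT (Torus.majorTranspose ((1 / (n : ℝ) ^ 2) • 𝔸)) (classFreq n ℓ z.1) (transversalProj (classFreq n ℓ z.1) y)) -
        transversalProj (classFreq n ℓ z.1) (transversalProj z.1 (Torus.symbT (Torus.majorTranspose 𝔸) z.1 (transversalProj z.1 y))))⟫_ℂ).re| ≤
      (1 / 4) * (8 * Real.pi ^ 2 * (lo / (n : ℝ) ^ 2) * freqNormSq (classFreq n ℓ z.1)) * ‖r‖ ^ 2 +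
        (32 * Real.pi ^ 2 * 534 ^ 2 * (hi + β / 2) ^ 2 / lo) * (Real.sqrt (freqNormSq ℓ) / n) ^ 2 * ‖y‖ ^ 2 := by
  have hz0 : (z : Fin 3 → ℤ) ≠ 0 := ne_zero_of_mem_box z.2
  have hn0 : (0 : ℝ) < n := by exact_mod_cast Nat.pos_of_ne_zero hn
  set ξ := Real.sqrt (freqNormSq ℓ) / n with hξ
  have hξ0 : 0 ≤ ξ := by positivity
  have hK₀ : 0 ≤ hi + β / 2 := by positivity
  -- transverse bound for the transposed tensor
  have hT : Torus.NearIso (Torus.majorTranspose 𝔸) lo hi := (Torus.nearIso_majorTranspose_iff 𝔸 lo hi).2 h𝔸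
  have hoddT : Torus.OddSmall (Torus.majorTranspose 𝔸) β := by
    intro k p q hp hq
    have h := hodd k q p hq hp
    rw [Torus.bsymb_majorTranspose, Torus.bsymb_majorTranspose]
    calc (Torus.bsymb 𝔸 k q p - Torus.bsymb 𝔸 k p q) ^ 2 ≤ β ^ 2 * ((∑ a, k a ^ 2) ^ 2 * ((∑ i, q i ^ 2) * ∑ i, p i ^ 2)) := h
      _ = β ^ 2 * ((∑ a, k a ^ 2) ^ 2 * ((∑ i, p i ^ 2) * ∑ i, q i ^ 2)) := by ring
  have hK := fun k p q hp hq => ThreeMode.abs_bsymb_le hT hlo.le hhi hoddT hβ k p q hp hq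
  -- closeness `4|ℓ|² ≤ n²|z|²`
  have hZ1 : 1 ≤ Real.sqrt (freqNormSq z.1) := by
    rw [← Real.sqrt_one]; exact Real.sqrt_le_sqrt (Torus.one_le_freqNormSq_of_ne_zero hz0)
  have hclose : 4 * freqNormSq ℓ ≤ (n : ℝ) ^ 2 * freqNormSq z.1 := by
    have h1 : Real.sqrt (freqNormSq ℓ) ≤ n / 2 := by linarith
    have h2 : freqNormSq ℓ = Real.sqrt (freqNormSq ℓ) ^ 2 := (Real.sq_sqrt (freqNormSq_nonneg ℓ)).symm
    have h3 : 1 ≤ freqNormSq z.1 := Torus.one_le_freqNormSq_of_ne_zero hz0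
    have h4 : Real.sqrt (freqNormSq ℓ) ^ 2 ≤ (n / 2) ^ 2 := pow_le_pow_left₀ (Real.sqrt_nonneg _) h1 2
    nlinarith
  have hmain := abs_re_inner_visc_defect_le hK₀ hK hn ℓ hz0 hclose hr y
  -- the dissipation weight dominates `n²|z|²/4`
  have hkz := sqrt_freqNormSq_classFreq_ge_half hℓ z
  have hW : (n : ℝ) ^ 2 * freqNormSq z.1 / 4 ≤ freqNormSq (classFreq n ℓ z.1) := by
    have h2 : freqNormSq (classFreq n ℓ z.1) = Real.sqrt (freqNormSq (classFreq n ℓ z.1)) ^ 2 := (Real.sq_sqrt (freqNormSq_nonneg _)).symm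
    have h3 : freqNormSq z.1 = Real.sqrt (freqNormSq z.1) ^ 2 := (Real.sq_sqrt (freqNormSq_nonneg _)).symm
    rw [h2, h3]
    have h0 : 0 ≤ (n : ℝ) * Real.sqrt (freqNormSq z.1) / 2 := by positivity
    nlinarith [pow_le_pow_left₀ h0 hkz 2]
  -- Young: `2·X·‖y‖‖r‖ ≤ A‖r‖² + X²‖y‖²/A`
  set X := 4 * Real.pi ^ 2 * (534 * (hi + β / 2) * Real.sqrt (freqNormSq z.1) * ξ) with hX
  have hX0 : 0 ≤ X := by positivity
  set A := (1 / 4) * (8 * Real.pi ^ 2 * (lo / (n : ℝ) ^ 2) * freqNormSq (classFreq n ℓ z.1)) with hA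
  have hA0 : 0 < A := by
    have hfz : 0 < freqNormSq z.1 := lt_of_lt_of_le one_pos (Torus.one_le_freqNormSq_of_ne_zero hz0)
    have : 0 < freqNormSq (classFreq n ℓ z.1) := lt_of_lt_of_le (by positivity) hW
    positivity
  have hb : 2 * |(⟪r, (((4 * Real.pi ^ 2 : ℝ) : ℂ)) • (transversalProj (classFreq n ℓ z.1)
          (Torus.symbT (Torus.majorTranspose ((1 / (n : ℝ) ^ 2) • 𝔸)) (classFreq n ℓ z.1) (transversalProj (classFreq n ℓ z.1) y)) -
        transversalProj (classFreq n ℓ z.1) (transversalProj z.1 (Torus.symbT (Torus.majorTranspose 𝔸) z.1 (transversalProj z.1 y))))⟫_ℂ).re|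
      ≤ 2 * (X * (‖y‖ * ‖r‖)) := by
    rw [hX]; nlinarith [hmain]
  have hyoung : 2 * (X * (‖y‖ * ‖r‖)) ≤ A * ‖r‖ ^ 2 + X ^ 2 / A * ‖y‖ ^ 2 := by
    have hsq : 0 ≤ (A * ‖r‖ - X * ‖y‖) ^ 2 / A := div_nonneg (sq_nonneg _) hA0.le
    have hexp : (A * ‖r‖ - X * ‖y‖) ^ 2 / A = A * ‖r‖ ^ 2 - 2 * (X * (‖y‖ * ‖r‖)) + X ^ 2 / A * ‖y‖ ^ 2 := by
      field_simp; ring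
    linarith [hsq, hexp]
  -- `X²/A ≤ (32π²534²K₀²/lo)·ξ²`
  have hXA : X ^ 2 / A ≤ (32 * Real.pi ^ 2 * 534 ^ 2 * (hi + β / 2) ^ 2 / lo) * ξ ^ 2 := by
    rw [div_le_iff₀ hA0, hX, hA]
    have hπ : 0 < Real.pi ^ 2 := by positivity
    -- `(4π²·534K₀√|z|²ξ)² ≤ (32π²534²K₀²ξ²/lo) · ¼·8π²(lo/n²)|k_z|²` ⟸ `|z|² ≤ (1/n²)·|k_z|²·4` ⟸ `hW`
    have hz2 : Real.sqrt (freqNormSq z.1) ^ 2 = freqNormSq z.1 := Real.sq_sqrt (freqNormSq_nonneg _)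
    have key : (4 * Real.pi ^ 2 * (534 * (hi + β / 2) * Real.sqrt (freqNormSq z.1) * ξ)) ^ 2
        = 32 * Real.pi ^ 2 * 534 ^ 2 * (hi + β / 2) ^ 2 / lo * ξ ^ 2 *
            (1 / 4 * (8 * Real.pi ^ 2 * (lo / (n : ℝ) ^ 2) * ((n : ℝ) ^ 2 * freqNormSq z.1 / 4))) := by
      rw [mul_pow, mul_pow, mul_pow, mul_pow, hz2]
      field_simp
      ring
    rw [key]
    gcongr
  calc _ ≤ 2 * (X * (‖y‖ * ‖r‖)) := hb
    _ ≤ A * ‖r‖ ^ 2 + X ^ 2 / A * ‖y‖ ^ 2 := hyoung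
    _ ≤ A * ‖r‖ ^ 2 + (32 * Real.pi ^ 2 * 534 ^ 2 * (hi + β / 2) ^ 2 / lo) * ξ ^ 2 * ‖y‖ ^ 2 := by
        gcongr
    _ = _ := by rw [hA]

/-! ## §3 The whole group D1 against the residual -/

/-- Fibrewise: `2Re⟪a, −V − S − C + 0⟫ ≤ 2|Re⟪a, V⟫| + 2‖a‖‖S‖ + 2‖a‖‖C‖`. [folklore] -/
theorem two_re_inner_neg_sub_sub_le (a V S C : EuclideanSpace ℂ (Fin 3)) :
    2 * (⟪a, -V - S - C + 0⟫_ℂ).re ≤ 2 * |(⟪a, V⟫_ℂ).re| + 2 * (‖a‖ * ‖S‖) + 2 * (‖a‖ * ‖C‖) := by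
  rw [add_zero, inner_sub_right, inner_sub_right, inner_neg_right, Complex.sub_re, Complex.sub_re, Complex.neg_re]
  have h1 : -(⟪a, V⟫_ℂ).re ≤ |(⟪a, V⟫_ℂ).re| := neg_le_abs _
  have h2 : -(⟪a, S⟫_ℂ).re ≤ ‖a‖ * ‖S‖ := (neg_le_abs _).trans ((Complex.abs_re_le_norm _).trans (norm_inner_le_norm a S))
  have h3 : -(⟪a, C⟫_ℂ).re ≤ ‖a‖ * ‖C‖ := (neg_le_abs _).trans ((Complex.abs_re_le_norm _).trans (norm_inner_le_norm a C))
  linarith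

set_option maxHeartbeats 400000 in
/-- **THE GROUP D1 AGAINST THE RESIDUAL**: for a class-transversal `r` and a `z`-transversal `y` (`2|ℓ| ≤ n`, `𝔹 = (1/n²)•𝔸`, any augmentations),
`2⟪r, genX t (projX y) − projX (gen t y)⟫_ℝ ≤ ¼·𝒟(r) + (32π²534²K₀²/lo)·ξ²·‖y‖² + 4·(Σⱼ 2π‖αⱼ‖(5 + 3|mⱼ|))·ξ·‖r‖‖y‖`.
[cite: MajdaKramer1999, §2.2.1.3 (cell problem (49))] [cite: Frisch1995Turbulence, §9.6.3 eq. (9.57) p. 233] -/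
theorem two_real_inner_D1_le (W₁ : LatticeWord k₀) {𝔸 : Torus.Visc4 (Fin 3)} {lo hi β : ℝ} (h𝔸 : Torus.NearIso 𝔸 lo hi) (hlo : 0 < lo)
    (hhi : 0 ≤ hi) (hodd : Torus.OddSmall 𝔸 β) (hβ : 0 ≤ β) {n : ℕ} (hn : n ≠ 0) {ℓ : Fin 3 → ℤ} (hℓ : 2 * Real.sqrt (freqNormSq ℓ) ≤ n)
    {R : ℕ} (γ₁ γ₁' : ℝ) (t : ℝ) {r y : Space R}
    (hr : ∀ z : box R, transversalProj (classFreq n ℓ z.1) (r z) = r z) (hy : ∀ z : box R, transversalProj z.1 (y z) = y z) :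
    2 * ⟪r, genX W₁ n ℓ ((1 / (n : ℝ) ^ 2) • 𝔸) γ₁ R t (projX n ℓ R y) - projX n ℓ R (gen W₁ 𝔸 γ₁' R t y)⟫_ℝ ≤
      (1 / 4) * (8 * Real.pi ^ 2 * (lo / (n : ℝ) ^ 2) * ∑ z : box R, freqNormSq (classFreq n ℓ z.1) * ‖r z‖ ^ 2) +
        (32 * Real.pi ^ 2 * 534 ^ 2 * (hi + β / 2) ^ 2 / lo) * (Real.sqrt (freqNormSq ℓ) / n) ^ 2 * ‖y‖ ^ 2 +
        4 * (∑ j, 2 * Real.pi * ‖slotAmp W₁ j‖ * (5 + 3 * Real.sqrt (freqNormSq (W₁.phase j).m))) * (Real.sqrt (freqNormSq ℓ) / n) * (‖r‖ * ‖y‖) := by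
  set ξ := Real.sqrt (freqNormSq ℓ) / n with hξ
  have hξ0 : 0 ≤ ξ := by positivity
  set Cv := 32 * Real.pi ^ 2 * 534 ^ 2 * (hi + β / 2) ^ 2 / lo with hCv
  -- names for the fibre quantities
  set V : box R → EuclideanSpace ℂ (Fin 3) := fun z => (((4 * Real.pi ^ 2 : ℝ) : ℂ)) • (transversalProj (classFreq n ℓ z.1)
      (Torus.symbT (Torus.majorTranspose ((1 / (n : ℝ) ^ 2) • 𝔸)) (classFreq n ℓ z.1) (transversalProj (classFreq n ℓ z.1) (y z))) -
    transversalProj (classFreq n ℓ z.1) (transversalProj z.1 (Torus.symbT (Torus.majorTranspose 𝔸) z.1 (transversalProj z.1 (y z))))) with hV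
  set S : box R → Fin k₀ → EuclideanSpace ℂ (Fin 3) := fun z j => linkCoeff W₁ n ℓ j t • transversalProj (classFreq n ℓ z.1)
      (slotAmp W₁ j • transversalProj (classFreq n ℓ (z.1 - (W₁.phase j).m)) (coordL R (z.1 - (W₁.phase j).m) y) +
        starRingEnd ℂ (slotAmp W₁ j) • transversalProj (classFreq n ℓ (z.1 + (W₁.phase j).m)) (coordL R (z.1 + (W₁.phase j).m) y)) with hS
  set Cm : box R → Fin k₀ → EuclideanSpace ℂ (Fin 3) := fun z j => linkCoeff W₁ 1 z.1 j t • transversalProj (classFreq n ℓ z.1)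
      (slotAmp W₁ j • (transversalProj (classFreq n ℓ (z.1 - (W₁.phase j).m)) (coordL R (z.1 - (W₁.phase j).m) y) -
          transversalProj z.1 (transversalProj (z.1 - (W₁.phase j).m) (coordL R (z.1 - (W₁.phase j).m) y))) +
        starRingEnd ℂ (slotAmp W₁ j) • (transversalProj (classFreq n ℓ (z.1 + (W₁.phase j).m)) (coordL R (z.1 + (W₁.phase j).m) y) -
          transversalProj z.1 (transversalProj (z.1 + (W₁.phase j).m) (coordL R (z.1 + (W₁.phase j).m) y)))) with hCm
  -- the fibre identity
  have hfib : ∀ z : box R, (genX W₁ n ℓ ((1 / (n : ℝ) ^ 2) • 𝔸) γ₁ R t (projX n ℓ R y) - projX n ℓ R (gen W₁ 𝔸 γ₁' R t y)) z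
      = -V z - ∑ j, S z j - ∑ j, Cm z j + 0 := by
    intro z
    have haug : ((γ₁' : ℝ) : ℂ) • transversalProj (classFreq n ℓ z.1) (y z - transversalProj z.1 (y z)) = 0 := by
      rw [hy z, sub_self, map_zero, smul_zero]
    rw [PiLp.sub_apply, genX_projX_sub_projX_gen_apply W₁ hn ℓ ((1 / (n : ℝ) ^ 2) • 𝔸) 𝔸 γ₁ γ₁' t y z, haug]
  -- fibre bounds
  have hz : ∀ z : box R, 2 * (⟪r z, (genX W₁ n ℓ ((1 / (n : ℝ) ^ 2) • 𝔸) γ₁ R t (projX n ℓ R y) - projX n ℓ R (gen W₁ 𝔸 γ₁' R t y)) z⟫_ℂ).re ≤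
      ((1 / 4) * (8 * Real.pi ^ 2 * (lo / (n : ℝ) ^ 2) * freqNormSq (classFreq n ℓ z.1)) * ‖r z‖ ^ 2 + Cv * ξ ^ 2 * ‖y z‖ ^ 2) +
        2 * (‖r z‖ * ∑ j, ‖S z j‖) + 2 * (‖r z‖ * ∑ j, ‖Cm z j‖) := by
    intro z
    rw [hfib z]
    refine (two_re_inner_neg_sub_sub_le (r z) (V z) (∑ j, S z j) (∑ j, Cm z j)).trans ?_
    have hv := two_abs_re_inner_visc_le h𝔸 hlo hhi hodd hβ hn hℓ z (hr z) (y z)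
    gcongr
    · exact norm_sum_le _ _
    · exact norm_sum_le _ _
  -- sum over the box
  rw [real_inner_space_eq_sum, Finset.mul_sum]
  refine (Finset.sum_le_sum fun z _ => hz z).trans ?_
  rw [Finset.sum_add_distrib, Finset.sum_add_distrib, Finset.sum_add_distrib]
  -- the four sums
  have e1 : ∑ z : box R, (1 / 4) * (8 * Real.pi ^ 2 * (lo / (n : ℝ) ^ 2) * freqNormSq (classFreq n ℓ z.1)) * ‖r z‖ ^ 2
      = (1 / 4) * (8 * Real.pi ^ 2 * (lo / (n : ℝ) ^ 2) * ∑ z : box R, freqNormSq (classFreq n ℓ z.1) * ‖r z‖ ^ 2) := by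
    rw [Finset.mul_sum, Finset.mul_sum]; exact Finset.sum_congr rfl fun z _ => by ring
  have e2 : ∑ z : box R, Cv * ξ ^ 2 * ‖y z‖ ^ 2 = Cv * ξ ^ 2 * ‖y‖ ^ 2 := by
    rw [← Finset.mul_sum, PiLp.norm_sq_eq_of_L2]
  have e3 : ∑ z : box R, 2 * (‖r z‖ * ∑ j, ‖S z j‖) ≤ ∑ j, 2 * (2 * (2 * Real.pi * ξ * ‖slotAmp W₁ j‖) * (‖r‖ * ‖y‖)) := by
    have hswap : ∑ z : box R, 2 * (‖r z‖ * ∑ j, ‖S z j‖) = ∑ j, 2 * ∑ z : box R, ‖r z‖ * ‖S z j‖ := by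
      simp_rw [Finset.mul_sum]; rw [Finset.sum_comm]
    rw [hswap]
    refine Finset.sum_le_sum fun j _ => mul_le_mul_of_nonneg_left ?_ (by norm_num)
    refine sum_norm_mul_le_of_neighbour_bound (W₁.phase j).m r y (by positivity) fun z => ?_
    have h := norm_slow_link_le W₁ n ℓ j t y z
    rw [← hξ] at h
    exact h
  have e4 : ∑ z : box R, 2 * (‖r z‖ * ∑ j, ‖Cm z j‖) ≤
      ∑ j, 2 * (2 * (2 * Real.pi * ξ * ‖slotAmp W₁ j‖ * (4 + 3 * Real.sqrt (freqNormSq (W₁.phase j).m))) * (‖r‖ * ‖y‖)) := by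
    have hswap : ∑ z : box R, 2 * (‖r z‖ * ∑ j, ‖Cm z j‖) = ∑ j, 2 * ∑ z : box R, ‖r z‖ * ‖Cm z j‖ := by
      simp_rw [Finset.mul_sum]; rw [Finset.sum_comm]
    rw [hswap]
    refine Finset.sum_le_sum fun j _ => mul_le_mul_of_nonneg_left ?_ (by norm_num)
    refine sum_norm_mul_le_of_neighbour_bound (W₁.phase j).m r y (by positivity) fun z => ?_
    have h := norm_link_commutator_le W₁ hn hℓ j t y z
    rw [← hξ] at h
    exact h
  have e34 : ∑ j, 2 * (2 * (2 * Real.pi * ξ * ‖slotAmp W₁ j‖) * (‖r‖ * ‖y‖)) +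
      ∑ j, 2 * (2 * (2 * Real.pi * ξ * ‖slotAmp W₁ j‖ * (4 + 3 * Real.sqrt (freqNormSq (W₁.phase j).m))) * (‖r‖ * ‖y‖))
      = 4 * (∑ j, 2 * Real.pi * ‖slotAmp W₁ j‖ * (5 + 3 * Real.sqrt (freqNormSq (W₁.phase j).m))) * ξ * (‖r‖ * ‖y‖) := by
    rw [← Finset.sum_add_distrib, Finset.mul_sum, Finset.sum_mul, Finset.sum_mul]
    exact Finset.sum_congr rfl fun j _ => by ring
  rw [e1, e2]
  linarith [e3, e4, e34]

end Summit.AnomalousDissipation.AnomalousDissipation.Theorems.SolenoidalFractalHomogenisation.LagrangianStep.Sideband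

end
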